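import Literature.Computability.AlgebraicComplexity.ConstituentYCompatibility
import HarnessLib

/-!
# Claim 6.19: `Y`-compatibility one level down through the partition
`{S_{t,i',j',0}} ∪ {S_{t,*,j',+}}` (Alman–Duan–Vassilevska Williams–Xu–Xu–Zhou 2025, §6.5) — proved

Topic `Literature/Computability/AlgebraicComplexity`.  In the proof of Claim 6.18 of Alman–Duan–
Vassilevska Williams–Xu–Xu–Zhou, *More asymmetry yields faster matrix multiplication* (SODA 2025,
arXiv:2404.16349), the number of level-1 `Y`-blocks `Y`-compatible (Def. 6.8) with a fixed
`{α_t}`-consistent level-`(ℓ−1)` triple is computed class by class thanks to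

> **Claim 6.19.** Given a … triple `X_I Y_J Z_K` that is consistent with `{α_t}`, a level-1 block `Y_Ĵ`
> with `Y_Ĵ ∈ Y_J` is compatible with `X_I Y_J Z_K` if and only if: for every `t` and every `(i',j',k')`
> in the box with `k' = 0`, `split(Ĵ, S_{t,i',j',k'}) = β_{Y,t,i',j',k'}`; for every `t` and `j'`,
> `split(Ĵ, S_{t,*,j',+}) = β̄_{Y,t,*,j',+}`, where `S_{t,*,j',+} = ⋃_{i' ≥ 0, k' > 0} S_{t,i',j',k'}`.
> "The benefit of the above claim is that `{S_{t,i',j',0}}_{t,i',j'} ∪ {S_{t,*,j',+}}_{t,j'}` forms a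
> partition … Thus, we can compute the possibilities of `Ĵ` on each of these subsets."

(whose proof the paper omits — it is the averaging argument of Claim 5.18).  This file PROVES it on the
vocabulary of `ConstituentYCompatibility.lean` (the level-`ℓ` version is `YCompatibility.advxxz2025_claim518`):

* `pairClassYpos` (**`S_{t,*,j',+}`**), `boxTriplesYpos` (the box triples with `k' > 0`),
  `card_filter_pairClassYpos_eq_sum`, `completeSplitOn_pairClassYpos_mul_card`, `card_pairClassYpos_eq_sum`
  — `S_{t,*,j',+}` is the disjoint union of the `S_{t,i',j',k'}`, `k' > 0`, and the averaging identity;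
* `betaBarYpos` — **`β̄_{Y,t,*,j',+}`**, the weighted average of the `β_{Y,t,i',j',k'}`, `k' > 0`, with the
  weights `α_t(i',j',k') + α_t(i_t−i',j_t−j',k_t−k')` (as counts `cnt t`);
* `typicalY₂_at_iff`, `posCondY₂_at_iff` — typicalness on `S_{t,*,j',*}`, resp. the condition on
  `S_{t,*,j',+}`, as the equality of the class-size-weighted sums of splits and of targets over the box,
  resp. over its `k' > 0` part;
* `advxxz2025_claim619` — **Claim 6.19** (conditions on occurring classes), for an `{α_t}`-consistent
  triple inside the level-`ℓ` blocks.

Everything is proved; the definitions are `pairClassYpos`, `boxTriplesYpos`, `betaBarYpos`; no named facts.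

## References

* J. Alman, R. Duan, V. Vassilevska Williams, Y. Xu, Z. Xu, R. Zhou, *More asymmetry yields faster
  matrix multiplication*, SODA 2025, arXiv:2404.16349 (held: `paper:arxiv-2404.16349`, chunk p0025):
  Claim 6.19 and the proof of Claim 6.18; Claim 5.18 (the level-`ℓ` original).
  [AlmanDuanVassilevskaWilliamsXuXuZhou2025]
-/

noncomputable section

open scoped BigOperators
open Finset

namespace Literature.Computability.AlgebraicComplexity

section Claim619

variable {c n s : ℕ} (τ : Fin n → Fin s)

/-! ## The classes `S_{t,*,j',+}` and the `k' > 0` part of the box -/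

/-- **`S_{t,*,j',+} = ⋃_{i' ≥ 0, k' > 0} S_{t,i',j',k'}`**: the half-chunk positions of term `t` with `J_p = j'`
and `K_p > 0`. [cite: AlmanDuanVassilevskaWilliamsXuXuZhou2025, Claim 6.19 (S_{t,*,j',+})] -/
def pairClassYpos (J K : Fin (n + n) → ℕ) (t : Fin s) (j : ℕ) : Finset (Fin (n + n)) :=
  univ.filter fun p => halfTermOf τ p = t ∧ J p = j ∧ 0 < K p

/-- Membership. [folklore] -/
@[simp] theorem mem_pairClassYpos {J K : Fin (n + n) → ℕ} {t : Fin s} {j : ℕ} {p : Fin (n + n)} :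
    p ∈ pairClassYpos τ J K t j ↔ halfTermOf τ p = t ∧ J p = j ∧ 0 < K p := by
  simp [pairClassYpos]

/-- `S_{t,*,j',+} ⊆ S_{t,*,j',*}`. [cite: AlmanDuanVassilevskaWilliamsXuXuZhou2025, Claim 6.19] -/
theorem pairClassYpos_subset_pairClassY (J K : Fin (n + n) → ℕ) (t : Fin s) (j : ℕ) :
    pairClassYpos τ J K t j ⊆ pairClassY τ J t j := by
  intro p hp
  rw [mem_pairClassYpos] at hp
  exact (mem_pairClassY τ).2 ⟨hp.1, hp.2.1⟩

/-- `S_{t,i',j',k'} ⊆ S_{t,*,j',+}` for `k' > 0`. [cite: AlmanDuanVassilevskaWilliamsXuXuZhou2025, Claim 6.19] -/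
theorem pairClass_subset_pairClassYpos (I J K : Fin (n + n) → ℕ) (t : Fin s) (i j : ℕ) {k : ℕ} (hk : 0 < k) :
    pairClass τ I J K t i j k ⊆ pairClassYpos τ J K t j := by
  intro p hp
  rw [mem_pairClass] at hp
  exact (mem_pairClassYpos τ).2 ⟨hp.1, hp.2.2.1, hp.2.2.2.symm ▸ hk⟩

/-- **The `k' > 0` part of the `Y`-box.** [cite: AlmanDuanVassilevskaWilliamsXuXuZhou2025, Claim 6.19 ("i' ≥ 0, k' > 0")] -/
def boxTriplesYpos (c : ℕ) (T : InterfaceTerm (c + c)) (j : ℕ) : Finset (ℕ × ℕ × ℕ) :=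
  (boxTriplesY c T j).filter fun ijk => 0 < ijk.2.2

omit τ in
/-- Membership in the `k' > 0` part of the `Y`-box. [folklore] -/
theorem mem_boxTriplesYpos {T : InterfaceTerm (c + c)} {j : ℕ} {ijk : ℕ × ℕ × ℕ} :
    ijk ∈ boxTriplesYpos c T j ↔ ijk ∈ boxTriplesY c T j ∧ 0 < ijk.2.2 := mem_filter

omit τ in
/-- The `k' > 0` part is contained in the box. [folklore] -/
theorem boxTriplesYpos_subset (c : ℕ) (T : InterfaceTerm (c + c)) (j : ℕ) : boxTriplesYpos c T j ⊆ boxTriplesY c T j :=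
  filter_subset _ _

omit τ in
/-- **Sums over the box split into the `k' = 0` part and the `k' > 0` part.** [cite: AlmanDuanVassilevskaWilliamsXuXuZhou2025, Claim 6.19 ("forms a partition")] -/
theorem sum_boxTriplesY_eq_add (T : InterfaceTerm (c + c)) (j : ℕ) (f : ℕ × ℕ × ℕ → ℝ) :
    ∑ ijk ∈ boxTriplesY c T j, f ijk =
      ∑ ijk ∈ (boxTriplesY c T j).filter (fun ijk => ijk.2.2 = 0), f ijk + ∑ ijk ∈ boxTriplesYpos c T j, f ijk := by
  have hb : boxTriplesYpos c T j = (boxTriplesY c T j).filter fun ijk => ¬ijk.2.2 = 0 := by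
    unfold boxTriplesYpos
    exact filter_congr fun ijk _ => Nat.pos_iff_ne_zero
  rw [hb, sum_filter_add_sum_filter_not]

variable (L : Fin s → InterfaceTerm (c + c))

/-- **`S_{t,*,j',+}` decomposes over the `k' > 0` part of the box** (for a level triple inside the level-`ℓ`
blocks, any predicate `Q`). [cite: AlmanDuanVassilevskaWilliamsXuXuZhou2025, Claim 6.19] -/
theorem card_filter_pairClassYpos_eq_sum {I J K : Fin (n + n) → ℕ} (h : IsLevelTriple c I J K)
    (hI : ∀ u, I (Fin.castAdd n u) + I (Fin.natAdd n u) = (L (τ u)).i)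
    (hJ : ∀ u, J (Fin.castAdd n u) + J (Fin.natAdd n u) = (L (τ u)).j)
    (hK : ∀ u, K (Fin.castAdd n u) + K (Fin.natAdd n u) = (L (τ u)).k)
    (t : Fin s) (j : ℕ) (Q : Fin (n + n) → Prop) [DecidablePred Q] :
    ((pairClassYpos τ J K t j).filter Q).card =
      ∑ ijk ∈ boxTriplesYpos c (L t) j, ((pairClass τ I J K t ijk.1 ijk.2.1 ijk.2.2).filter Q).card := by
  rw [card_eq_sum_card_fiberwise (f := fun p => (I p, J p, K p)) (s := (pairClassYpos τ J K t j).filter Q)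
    (t := boxTriplesYpos c (L t) j) ?_]
  · refine sum_congr rfl fun ijk hijk => ?_
    obtain ⟨i, j', k⟩ := ijk
    rw [mem_boxTriplesYpos, mem_boxTriplesY] at hijk
    have hj' : j' = j := hijk.1.2.1
    have hk : 0 < k := hijk.2
    congr 1
    ext p
    simp only [mem_filter, mem_pairClassYpos, mem_pairClass, Prod.mk.injEq]
    constructor
    · rintro ⟨⟨⟨ht, -, -⟩, hq⟩, h1, h2, h3⟩
      exact ⟨⟨ht, h1, h2, h3⟩, hq⟩
    · rintro ⟨⟨ht, h1, h2, h3⟩, hq⟩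
      exact ⟨⟨⟨ht, h2.trans hj', h3.symm ▸ hk⟩, hq⟩, h1, h2, h3⟩
  · intro p hp
    have hp' := mem_filter.1 hp
    obtain ⟨ht, hj, hKp⟩ := (mem_pairClassYpos τ).1 hp'.1
    show (I p, J p, K p) ∈ boxTriplesYpos c (L t) j
    rw [mem_boxTriplesYpos, ← hj, ← ht]
    exact ⟨triple_mem_boxTriplesY τ L h hI hJ hK p, hKp⟩

/-- **The averaging identity on `S_{t,*,j',+}`**:
`split(Ĵ, S_{t,*,j',+})(σ) · |S_{t,*,j',+}| = ∑_{box, k'>0} split(Ĵ, S_{t,i',j',k'})(σ) · |S_{t,i',j',k'}|`.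
[cite: AlmanDuanVassilevskaWilliamsXuXuZhou2025, Claim 6.19 and Claim 5.18 (proof)] -/
theorem completeSplitOn_pairClassYpos_mul_card {I J K : Fin (n + n) → ℕ} (h : IsLevelTriple c I J K)
    (hI : ∀ u, I (Fin.castAdd n u) + I (Fin.natAdd n u) = (L (τ u)).i)
    (hJ : ∀ u, J (Fin.castAdd n u) + J (Fin.natAdd n u) = (L (τ u)).j)
    (hK : ∀ u, K (Fin.castAdd n u) + K (Fin.natAdd n u) = (L (τ u)).k)
    (Jh : Fin (n + n) → Fin c → Fin 3) (t : Fin s) (j : ℕ) (σ : Fin c → Fin 3) :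
    completeSplitOn Jh (pairClassYpos τ J K t j) σ * (pairClassYpos τ J K t j).card =
      ∑ ijk ∈ boxTriplesYpos c (L t) j, completeSplitOn Jh (pairClass τ I J K t ijk.1 ijk.2.1 ijk.2.2) σ *
        (pairClass τ I J K t ijk.1 ijk.2.1 ijk.2.2).card := by
  rw [completeSplitOn_mul_card, card_filter_pairClassYpos_eq_sum τ L h hI hJ hK t j (fun p => Jh p = σ)]
  push_cast
  exact sum_congr rfl fun ijk _ => (completeSplitOn_mul_card Jh _ σ).symm

/-- `|S_{t,*,j',+}| = ∑_{box, k'>0} |S_{t,i',j',k'}|`. [cite: AlmanDuanVassilevskaWilliamsXuXuZhou2025, Claim 6.19] -/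
theorem card_pairClassYpos_eq_sum {I J K : Fin (n + n) → ℕ} (h : IsLevelTriple c I J K)
    (hI : ∀ u, I (Fin.castAdd n u) + I (Fin.natAdd n u) = (L (τ u)).i)
    (hJ : ∀ u, J (Fin.castAdd n u) + J (Fin.natAdd n u) = (L (τ u)).j)
    (hK : ∀ u, K (Fin.castAdd n u) + K (Fin.natAdd n u) = (L (τ u)).k) (t : Fin s) (j : ℕ) :
    (pairClassYpos τ J K t j).card = ∑ ijk ∈ boxTriplesYpos c (L t) j, (pairClass τ I J K t ijk.1 ijk.2.1 ijk.2.2).card := by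
  have := card_filter_pairClassYpos_eq_sum τ L h hI hJ hK t j (fun _ => True)
  simpa using this

/-- **`β̄_{Y,t,*,j',+}`**: the weighted average over the `k' > 0` part of the box of the `β_{Y,t,i',j',k'}` with
weights `α_t(i',j',k') + α_t(i_t−i',j_t−j',k_t−k')` (given as real weights `w`; for an `{α_t}`-consistent triple
`w = cnt t`). [cite: AlmanDuanVassilevskaWilliamsXuXuZhou2025, Claim 6.19 (β̄_{Y,t,*,j',+}) and §6 (notation f̄)] -/
def betaBarYpos (c : ℕ) (T : InterfaceTerm (c + c)) (w : ℕ × ℕ × ℕ → ℝ) (βY : ℕ × ℕ × ℕ → (Fin c → Fin 3) → ℝ) (j : ℕ) :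
    (Fin c → Fin 3) → ℝ := fun σ =>
  (∑ ijk ∈ boxTriplesYpos c T j, (w ijk + w (T.i - ijk.1, T.j - ijk.2.1, T.k - ijk.2.2)) * βY ijk σ) /
    ∑ ijk ∈ boxTriplesYpos c T j, (w ijk + w (T.i - ijk.1, T.j - ijk.2.1, T.k - ijk.2.2))

/-! ## Typicalness and the condition on `S_{t,*,j',+}` as weighted-sum identities -/

/-- Class sizes in the box of an `{α_t}`-consistent triple inside the level-`ℓ` blocks:
`|S_{t,i',j',k'}| = cnt(i',j',k') + cnt(i_t−i',j_t−j',k_t−k')`. [cite: AlmanDuanVassilevskaWilliamsXuXuZhou2025, §6.5 ("A_{t,1} · (α_t(i',j',k') + α_t(i_t−i',j_t−j',k_t−k')) · n_t")] -/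
theorem card_pairClass_eq_cnt_of_mem_boxTriplesY {cnt : Fin s → ℕ × ℕ × ℕ → ℕ} {I J K : Fin (n + n) → Fin (2 * c + 1)}
    (hI : InsideX τ L I) (hJ : InsideY τ L J) (hK : InsideZ τ L K) (hcnt : IsAlphaTConsistent τ cnt (seqVal I) (seqVal J) (seqVal K))
    (t : Fin s) {j : ℕ} {ijk : ℕ × ℕ × ℕ} (hijk : ijk ∈ boxTriplesY c (L t) j) :
    ((pairClass τ (seqVal I) (seqVal J) (seqVal K) t ijk.1 ijk.2.1 ijk.2.2).card : ℝ) =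
      (cnt t ijk : ℝ) + cnt t ((L t).i - ijk.1, (L t).j - ijk.2.1, (L t).k - ijk.2.2) := by
  rw [mem_boxTriplesY] at hijk
  rw [card_pairClass_eq τ L hI hJ hK t hijk.2.2.1 hijk.2.2.2.1 hijk.2.2.2.2, ← hcnt t ijk, ← hcnt t _]
  push_cast
  rfl

/-- **Typicalness on `S_{t,*,j',*}` as a weighted-sum identity**: for an occurring class,
`split(Ĵ, S_{t,*,j',*}) = β̄_{Y,t,*,j',*}` iff `∑_box split(Ĵ, S_{t,i',j',k'})(σ) |S_{t,i',j',k'}| = ∑_box |S_{t,i',j',k'}| β_{Y,t,i',j',k'}(σ)`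
for every shape `σ`. [cite: AlmanDuanVassilevskaWilliamsXuXuZhou2025, Claim 5.18 (proof) and Claim 6.19] -/
theorem typicalY₂_at_iff {βY : Fin s → ℕ × ℕ × ℕ → (Fin c → Fin 3) → ℝ} {cnt : Fin s → ℕ × ℕ × ℕ → ℕ}
    {I J K : Fin (n + n) → Fin (2 * c + 1)} (h : IsLevelTriple c (seqVal I) (seqVal J) (seqVal K))
    (hI : InsideX τ L I) (hJ : InsideY τ L J) (hK : InsideZ τ L K) (hcnt : IsAlphaTConsistent τ cnt (seqVal I) (seqVal J) (seqVal K))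
    (Jh : Fin (n + n) → Fin c → Fin 3) (t : Fin s) (j : ℕ) (hne : (pairClassY τ (seqVal J) t j).Nonempty) :
    completeSplitOn Jh (pairClassY τ (seqVal J) t j) = betaBarY c (L t) (fun ijk => (cnt t ijk : ℝ)) (βY t) j ↔
      ∀ σ, ∑ ijk ∈ boxTriplesY c (L t) j, completeSplitOn Jh (pairClass τ (seqVal I) (seqVal J) (seqVal K) t ijk.1 ijk.2.1 ijk.2.2) σ *
            ((pairClass τ (seqVal I) (seqVal J) (seqVal K) t ijk.1 ijk.2.1 ijk.2.2).card : ℝ) =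
          ∑ ijk ∈ boxTriplesY c (L t) j, ((pairClass τ (seqVal I) (seqVal J) (seqVal K) t ijk.1 ijk.2.1 ijk.2.2).card : ℝ) * βY t ijk σ := by
  have hsize : ∀ ijk ∈ boxTriplesY c (L t) j,
      ((pairClass τ (seqVal I) (seqVal J) (seqVal K) t ijk.1 ijk.2.1 ijk.2.2).card : ℝ) =
        (cnt t ijk : ℝ) + cnt t ((L t).i - ijk.1, (L t).j - ijk.2.1, (L t).k - ijk.2.2) :=
    fun ijk hijk => card_pairClass_eq_cnt_of_mem_boxTriplesY τ L hI hJ hK hcnt t hijk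
  have hW : ((pairClassY τ (seqVal J) t j).card : ℝ) =
      ∑ ijk ∈ boxTriplesY c (L t) j, ((cnt t ijk : ℝ) + cnt t ((L t).i - ijk.1, (L t).j - ijk.2.1, (L t).k - ijk.2.2)) := by
    rw [card_pairClassY_eq_sum τ L h hI hJ hK t j]; push_cast
    exact sum_congr rfl hsize
  have hpos : (0 : ℝ) < (pairClassY τ (seqVal J) t j).card := by exact_mod_cast hne.card_pos
  have hR : ∀ σ, ∑ ijk ∈ boxTriplesY c (L t) j, ((cnt t ijk : ℝ) + cnt t ((L t).i - ijk.1, (L t).j - ijk.2.1, (L t).k - ijk.2.2)) * βY t ijk σ =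
      ∑ ijk ∈ boxTriplesY c (L t) j, ((pairClass τ (seqVal I) (seqVal J) (seqVal K) t ijk.1 ijk.2.1 ijk.2.2).card : ℝ) * βY t ijk σ :=
    fun σ => sum_congr rfl fun ijk hijk => by rw [hsize ijk hijk]
  rw [funext_iff]
  refine forall_congr' fun σ => ?_
  simp only [betaBarY]
  rw [eq_div_iff (by rw [← hW]; exact hpos.ne'), ← hW, completeSplitOn_pairClassY_mul_card τ L h hI hJ hK Jh t j σ, hR σ]

/-- **The condition on `S_{t,*,j',+}` as a weighted-sum identity**: for an occurring class,
`split(Ĵ, S_{t,*,j',+}) = β̄_{Y,t,*,j',+}` iff `∑_{box, k'>0} split(Ĵ, S_{t,i',j',k'})(σ) |S_{t,i',j',k'}| = ∑_{box, k'>0} |S_{t,i',j',k'}| β_{Y,t,i',j',k'}(σ)`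
for every shape `σ`. [cite: AlmanDuanVassilevskaWilliamsXuXuZhou2025, Claim 6.19] -/
theorem posCondY₂_at_iff {βY : Fin s → ℕ × ℕ × ℕ → (Fin c → Fin 3) → ℝ} {cnt : Fin s → ℕ × ℕ × ℕ → ℕ}
    {I J K : Fin (n + n) → Fin (2 * c + 1)} (h : IsLevelTriple c (seqVal I) (seqVal J) (seqVal K))
    (hI : InsideX τ L I) (hJ : InsideY τ L J) (hK : InsideZ τ L K) (hcnt : IsAlphaTConsistent τ cnt (seqVal I) (seqVal J) (seqVal K))
    (Jh : Fin (n + n) → Fin c → Fin 3) (t : Fin s) (j : ℕ) (hne : (pairClassYpos τ (seqVal J) (seqVal K) t j).Nonempty) :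
    completeSplitOn Jh (pairClassYpos τ (seqVal J) (seqVal K) t j) = betaBarYpos c (L t) (fun ijk => (cnt t ijk : ℝ)) (βY t) j ↔
      ∀ σ, ∑ ijk ∈ boxTriplesYpos c (L t) j, completeSplitOn Jh (pairClass τ (seqVal I) (seqVal J) (seqVal K) t ijk.1 ijk.2.1 ijk.2.2) σ *
            ((pairClass τ (seqVal I) (seqVal J) (seqVal K) t ijk.1 ijk.2.1 ijk.2.2).card : ℝ) =
          ∑ ijk ∈ boxTriplesYpos c (L t) j, ((pairClass τ (seqVal I) (seqVal J) (seqVal K) t ijk.1 ijk.2.1 ijk.2.2).card : ℝ) * βY t ijk σ := by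
  have hsize : ∀ ijk ∈ boxTriplesYpos c (L t) j,
      ((pairClass τ (seqVal I) (seqVal J) (seqVal K) t ijk.1 ijk.2.1 ijk.2.2).card : ℝ) =
        (cnt t ijk : ℝ) + cnt t ((L t).i - ijk.1, (L t).j - ijk.2.1, (L t).k - ijk.2.2) :=
    fun ijk hijk => card_pairClass_eq_cnt_of_mem_boxTriplesY τ L hI hJ hK hcnt t (boxTriplesYpos_subset c (L t) j hijk)
  have hW : ((pairClassYpos τ (seqVal J) (seqVal K) t j).card : ℝ) =
      ∑ ijk ∈ boxTriplesYpos c (L t) j, ((cnt t ijk : ℝ) + cnt t ((L t).i - ijk.1, (L t).j - ijk.2.1, (L t).k - ijk.2.2)) := by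
    rw [card_pairClassYpos_eq_sum τ L h hI hJ hK t j]; push_cast
    exact sum_congr rfl hsize
  have hpos : (0 : ℝ) < (pairClassYpos τ (seqVal J) (seqVal K) t j).card := by exact_mod_cast hne.card_pos
  have hR : ∀ σ, ∑ ijk ∈ boxTriplesYpos c (L t) j, ((cnt t ijk : ℝ) + cnt t ((L t).i - ijk.1, (L t).j - ijk.2.1, (L t).k - ijk.2.2)) * βY t ijk σ =
      ∑ ijk ∈ boxTriplesYpos c (L t) j, ((pairClass τ (seqVal I) (seqVal J) (seqVal K) t ijk.1 ijk.2.1 ijk.2.2).card : ℝ) * βY t ijk σ :=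
    fun σ => sum_congr rfl fun ijk hijk => by rw [hsize ijk hijk]
  rw [funext_iff]
  refine forall_congr' fun σ => ?_
  simp only [betaBarYpos]
  rw [eq_div_iff (by rw [← hW]; exact hpos.ne'), ← hW, completeSplitOn_pairClassYpos_mul_card τ L h hI hJ hK Jh t j σ, hR σ]

/-- Under item (1) of `Y`-compatibility the `k' = 0` parts of the two weighted sums agree.
[cite: AlmanDuanVassilevskaWilliamsXuXuZhou2025, Claim 6.19 and Claim 5.18 (proof)] -/
theorem sum_zeroPart_eq_of_item1 {βY : Fin s → ℕ × ℕ × ℕ → (Fin c → Fin 3) → ℝ} {I J K : Fin (n + n) → ℕ}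
    {Jh : Fin (n + n) → Fin c → Fin 3}
    (h1 : ∀ t i j k, k = 0 → (pairClass τ I J K t i j k).Nonempty → completeSplitOn Jh (pairClass τ I J K t i j k) = βY t (i, j, k))
    (T : InterfaceTerm (c + c)) (t : Fin s) (j : ℕ) (σ : Fin c → Fin 3) :
    ∑ ijk ∈ (boxTriplesY c T j).filter (fun ijk => ijk.2.2 = 0),
        completeSplitOn Jh (pairClass τ I J K t ijk.1 ijk.2.1 ijk.2.2) σ * ((pairClass τ I J K t ijk.1 ijk.2.1 ijk.2.2).card : ℝ) =
      ∑ ijk ∈ (boxTriplesY c T j).filter (fun ijk => ijk.2.2 = 0), ((pairClass τ I J K t ijk.1 ijk.2.1 ijk.2.2).card : ℝ) * βY t ijk σ := by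
  refine sum_congr rfl fun ijk hijk => ?_
  have hk : ijk.2.2 = 0 := (mem_filter.1 hijk).2
  rcases (pairClass τ I J K t ijk.1 ijk.2.1 ijk.2.2).eq_empty_or_nonempty with he | hne
  · rw [he, card_empty, Nat.cast_zero, mul_zero, zero_mul]
  · rw [h1 t ijk.1 ijk.2.1 ijk.2.2 hk hne, mul_comm]

/-- If `S_{t,*,j',+}` is empty, the `k' > 0` parts of both weighted sums vanish. [folklore] -/
theorem sum_posPart_eq_of_empty {βY : Fin s → ℕ × ℕ × ℕ → (Fin c → Fin 3) → ℝ} {I J K : Fin (n + n) → ℕ}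
    (Jh : Fin (n + n) → Fin c → Fin 3) (T : InterfaceTerm (c + c)) (t : Fin s) (j : ℕ)
    (he : pairClassYpos τ J K t j = ∅) (σ : Fin c → Fin 3) :
    ∑ ijk ∈ boxTriplesYpos c T j,
        completeSplitOn Jh (pairClass τ I J K t ijk.1 ijk.2.1 ijk.2.2) σ * ((pairClass τ I J K t ijk.1 ijk.2.1 ijk.2.2).card : ℝ) =
      ∑ ijk ∈ boxTriplesYpos c T j, ((pairClass τ I J K t ijk.1 ijk.2.1 ijk.2.2).card : ℝ) * βY t ijk σ := by
  have hcl : ∀ ijk ∈ boxTriplesYpos c T j, pairClass τ I J K t ijk.1 ijk.2.1 ijk.2.2 = ∅ := by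
    intro ijk hijk
    obtain ⟨hb, hk⟩ := mem_boxTriplesYpos.1 hijk
    have hj : ijk.2.1 = j := (mem_boxTriplesY.1 hb).2.1
    rw [Finset.eq_empty_iff_forall_notMem]
    intro p hp
    have hp' := pairClass_subset_pairClassYpos τ I J K t ijk.1 ijk.2.1 hk hp
    rw [hj, he] at hp'
    exact absurd hp' (by simp)
  have h0 : ∀ ijk ∈ boxTriplesYpos c T j, ((pairClass τ I J K t ijk.1 ijk.2.1 ijk.2.2).card : ℝ) = 0 := fun ijk hijk => by
    rw [hcl ijk hijk, card_empty, Nat.cast_zero]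
  rw [sum_eq_zero fun ijk hijk => by rw [h0 ijk hijk, mul_zero], sum_eq_zero fun ijk hijk => by rw [h0 ijk hijk, zero_mul]]

/-- **ADVXXZ Claim 6.19**: for an `{α_t}`-consistent level-`(ℓ−1)` triple `X_I Y_J Z_K` inside the level-`ℓ`
blocks, a level-1 block `Y_Ĵ ∈ Y_J` is `Y`-compatible with it (Def. 6.8) iff (1) `split(Ĵ, S_{t,i',j',k'}) =
β_{Y,t,i',j',k'}` on every occurring class with `k' = 0`, and (2) `split(Ĵ, S_{t,*,j',+}) = β̄_{Y,t,*,j',+}` on every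
occurring `S_{t,*,j',+}`. [cite: AlmanDuanVassilevskaWilliamsXuXuZhou2025, Claim 6.19] -/
theorem advxxz2025_claim619 {βY : Fin s → ℕ × ℕ × ℕ → (Fin c → Fin 3) → ℝ} {cnt : Fin s → ℕ × ℕ × ℕ → ℕ}
    {I J K : Fin (n + n) → Fin (2 * c + 1)} (h : IsLevelTriple c (seqVal I) (seqVal J) (seqVal K))
    (hI : InsideX τ L I) (hJ : InsideY τ L J) (hK : InsideZ τ L K) (hcnt : IsAlphaTConsistent τ cnt (seqVal I) (seqVal J) (seqVal K))
    (Jh : Fin (n + n) → Fin c → Fin 3) :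
    IsYCompatibleWith₂ τ L (fun t ijk => (cnt t ijk : ℝ)) βY (seqVal I) (seqVal J) (seqVal K) Jh ↔
      (∀ t i j k, k = 0 → (pairClass τ (seqVal I) (seqVal J) (seqVal K) t i j k).Nonempty →
          completeSplitOn Jh (pairClass τ (seqVal I) (seqVal J) (seqVal K) t i j k) = βY t (i, j, k)) ∧
        ∀ t j, (pairClassYpos τ (seqVal J) (seqVal K) t j).Nonempty →
          completeSplitOn Jh (pairClassYpos τ (seqVal J) (seqVal K) t j) = betaBarYpos c (L t) (fun ijk => (cnt t ijk : ℝ)) (βY t) j := by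
  constructor
  · rintro ⟨h1, htyp⟩
    refine ⟨h1, fun t j hne => ?_⟩
    have hneY : (pairClassY τ (seqVal J) t j).Nonempty := hne.mono (pairClassYpos_subset_pairClassY τ _ _ t j)
    have htot := (typicalY₂_at_iff τ L h hI hJ hK hcnt Jh t j hneY).1 (htyp t j hneY)
    rw [posCondY₂_at_iff τ L h hI hJ hK hcnt Jh t j hne]
    intro σ
    have hσ := htot σ
    rw [sum_boxTriplesY_eq_add, sum_boxTriplesY_eq_add (f := fun ijk => ((pairClass τ (seqVal I) (seqVal J) (seqVal K) t ijk.1 ijk.2.1 ijk.2.2).card : ℝ) * βY t ijk σ),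
      sum_zeroPart_eq_of_item1 τ h1 (L t) t j σ] at hσ
    exact add_left_cancel hσ
  · rintro ⟨h1, hpos⟩
    refine ⟨h1, fun t j hneY => ?_⟩
    rw [typicalY₂_at_iff τ L h hI hJ hK hcnt Jh t j hneY]
    intro σ
    rw [sum_boxTriplesY_eq_add, sum_boxTriplesY_eq_add (f := fun ijk => ((pairClass τ (seqVal I) (seqVal J) (seqVal K) t ijk.1 ijk.2.1 ijk.2.2).card : ℝ) * βY t ijk σ),
      sum_zeroPart_eq_of_item1 τ h1 (L t) t j σ, add_right_inj]
    rcases (pairClassYpos τ (seqVal J) (seqVal K) t j).eq_empty_or_nonempty with he | hne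
    · exact sum_posPart_eq_of_empty τ Jh (L t) t j he σ
    · exact (posCondY₂_at_iff τ L h hI hJ hK hcnt Jh t j hne).1 (hpos t j hne) σ

end Claim619

end Literature.Computability.AlgebraicComplexity
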